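import Literature.Analysis.ODE.ForcedSmoothDependence

/-!
# Energy window, part V-a — the second variation of a forced integral equation (the jet system)

Lineage `stmt-AtomisticToContinuum-9121` (`ExtensiveSnapshotIrreversibility`), K_fix half, leaf S3
`KernelTemperatureLipschitz`; record (G1*ᶜᶜ) ⟸ (SWM)ₐ ∧ (JMˣ)₁ ∧ (JMˣ)₂, (G1ℓ) ⟸ (SWM)_d ∧ (JM) ∧
(JMˣ)₁ ∧ (JMˣ)₂ (critic row 1107).  Cell decomp-a2c, lens «grading / quantitative ladder»,
generation 80, part V «SkeletonSecondVariation» = three files: V-a (this file, generic) → V-b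
`…SkeletonSecondVariation` (the chain: `D²Y` bound, pathwise Grönwall) → V-c
`…SkeletonSecondVariationMoments` (the leaf (JMˣ)₂ `SkeletonSecondVariationMoments` PROVED).

THIS FILE is model-free.  Setting of `Literature.Analysis.ODE.ForcedSmoothDependence`: Banach spaces
`E` (states) and `X` (parameters), a `C^{n+1}` field `Y : E → E`, a `C^{n+1}` forcing
`g : X → C([0,1], E)`, and the solution family `S : X → C([0,1], E)` of the forced integral equation
`S x = g x + ∫₀ Y ∘ S x` (exactly one solution per parameter).  The first variation
`w_δ = D S(x₀) δ` solves `w = Dg δ + ∫₀ DY(S x₀) w` (`fderiv_forcedSolution_family_eq`).  Here: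
* §1 small calculus on `C(I, E × E)`: `pairCurve (a, b) = (τ ↦ (a τ, b τ))` as a continuous linear
  map, integrands of the Robbin / Volterra operators in closed form for ALL times
  (`IccExtend_nemytskii_eq`, `IccExtend_applyCLM_nemytskii_eq`), the integral of a pair.
* §2 THE JET TRICK (Hartman, ODE, Ch. V Thm 3.1, for initial-value parameters; here for forcing
  parameters): the pair `S₁(x, δ) = (S x, D S(x) δ)` is THE solution family, over the parameter
  space `X × X`, of the forced equation with field `Y₁(v, w) = (Y v, DY(v) w)` (`jetField`) and
  forcing `g₁(x, δ) = (g x, Dg(x) δ)` (`jetCurve g`) — existence componentwise, uniqueness from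
  uniqueness for `S` and `volterra_unique`; its first variation along `(δ', 0)` is `(w_δ', W)`,
  `W = D²S(x₀)[δ'][δ]` (`fderiv_jetCurve_apply_inl`).
* §3 **the second-variation equation** (`fderiv_fderiv_forcedSolution_family_apply`):
  `W(τ) = D²g(x₀)[δ'][δ](τ) + ∫₀^τ (D²Y(S x₀(s))[w_δ'(s)][w_δ(s)] + DY(S x₀(s)) W(s)) ds`,
  the variational equation of the jet system read in the second component
  (`fderiv_jetField_apply`: `DY₁(v,w)(a,b) = (DY v a, DY v b + D²Y v a w)`), together with the
  evaluation identity `D²(x ↦ S x τ)[δ'][δ] = W(τ)` used by the chain (V-b).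
No instance / notation / option; no proof holes.  References: P. Hartman, Ordinary Differential
Equations (SIAM 2002), Ch. V Thm 3.1, Cor. 4.1 [cite: Hartman2002, Ch. V Thm. 3.1]; S. Lang,
Differential and Riemannian Manifolds (1995), Ch. IV §1 [cite: Lang1995, Ch. IV §1]. [folklore]
-/

noncomputable section

namespace Summit.AtomisticToContinuum.FouriersLaw.Theorems.ExtensiveSnapshotIrreversibility.EnergyWindow

open MeasureTheory Set unitInterval Function
open scoped ContDiff
open Literature.Analysis.ODE

universe u

section Calculus

variable {F H K : Type*} [NormedAddCommGroup F] [NormedSpace ℝ F] [NormedAddCommGroup H]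
  [NormedSpace ℝ H] [NormedAddCommGroup K] [NormedSpace ℝ K]

/-- Derivative of the evaluation `(y, h) ↦ c(y) h` of an operator-valued map at a moving vector:
`D((y, h) ↦ c(y) h)(p) = c(p.1) ∘ pr₂ + (Dc(p.1) ∘ pr₁)(·) p.2` (stated with the operator space
`H →L K` kept structured, which is the form the elaborator unifies). [folklore] -/
theorem hasFDerivAt_apply_fst_snd {c : F → H →L[ℝ] K} {c' : F →L[ℝ] H →L[ℝ] K} {p : F × H}
    (hc : HasFDerivAt c c' p.1) :
    HasFDerivAt (fun q : F × H => c q.1 q.2)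
      ((c p.1).comp (ContinuousLinearMap.snd ℝ F H) +
        (c'.comp (ContinuousLinearMap.fst ℝ F H)).flip p.2) p :=
  (hc.comp p hasFDerivAt_fst).clm_apply hasFDerivAt_snd

end Calculus

section ForcedJet

variable {E : Type u} [NormedAddCommGroup E] [NormedSpace ℝ E]
  {X : Type u} [NormedAddCommGroup X] [NormedSpace ℝ X]

/-! ## 1. Pairs of curves and the integrands in closed form -/

/-- The pairing `(a, b) ↦ (τ ↦ (a τ, b τ))`, a continuous linear map
`C(I, E) × C(I, E) →L C(I, E × E)` of norm `≤ 1`. [folklore] -/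
def pairCurve : C(I, E) × C(I, E) →L[ℝ] C(I, E × E) :=
  LinearMap.mkContinuous
    { toFun := fun ab => ab.1.prodMk ab.2
      map_add' := fun _ _ => ContinuousMap.ext fun _ => rfl
      map_smul' := fun _ _ => ContinuousMap.ext fun _ => rfl }
    1 fun ab => by
      rw [one_mul]
      refine (ContinuousMap.norm_le _ (norm_nonneg _)).2 fun τ => ?_
      change ‖(ab.1 τ, ab.2 τ)‖ ≤ ‖ab‖
      rw [Prod.norm_def, Prod.norm_def]
      exact max_le_max (ab.1.norm_coe_le_norm τ) (ab.2.norm_coe_le_norm τ)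

/-- Unfolding `pairCurve`. [folklore] -/
@[simp] theorem pairCurve_apply (a b : C(I, E)) : pairCurve (a, b) = a.prodMk b := rfl

omit [NormedSpace ℝ E] in
/-- The extension by constants of a pair of curves is the pair of the extensions. [folklore] -/
theorem IccExtend_prodMk (a b : C(I, E)) (s : ℝ) :
    IccExtend zero_le_one (a.prodMk b) s = (IccExtend zero_le_one a s, IccExtend zero_le_one b s) :=
  rfl

omit [NormedSpace ℝ E] in
/-- The Robbin integrand in closed form for all times: `(Y ∘ α)‾(s) = Y(ᾱ(s))` (bar = extension
by constants). [folklore] -/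
theorem IccExtend_nemytskii_eq {F : Type*} [NormedAddCommGroup F] {Y : E → F} (hY : Continuous Y)
    (α : C(I, E)) (s : ℝ) :
    IccExtend zero_le_one (nemytskii Y α) s = Y (IccExtend zero_le_one α s) := by
  simp only [Set.IccExtend, Function.comp_apply]
  exact nemytskii_apply (hY.comp (map_continuous α)) _

/-- The Volterra integrand in closed form for all times: `(A(α) w)‾(s) = A(ᾱ(s)) w̄(s)`.
[folklore] -/
theorem IccExtend_applyCLM_nemytskii_eq {F : Type*} [NormedAddCommGroup F] [NormedSpace ℝ F]
    {A : E → E →L[ℝ] F} (hA : Continuous A) (α w : C(I, E)) (s : ℝ) :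
    IccExtend zero_le_one (applyCLM (nemytskii A α) w) s =
      A (IccExtend zero_le_one α s) (IccExtend zero_le_one w s) := by
  simp only [Set.IccExtend, Function.comp_apply, applyCLM_apply]
  rw [nemytskii_apply (hA.comp (map_continuous α))]

omit [NormedAddCommGroup X] [NormedSpace ℝ X] in
/-- Zeros of the parametric Robbin map of a continuous field, in closed form:
`α(τ) = g(x)(τ) + ∫₀^τ Y(ᾱ(s)) ds`. [folklore] -/
theorem forcedRobbinMap_eq_zero_iff_integral {Y : E → E} (hY : Continuous Y) (g : X → C(I, E))
    (x : X) (α : C(I, E)) :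
    forcedRobbinMap Y g (x, α) = 0 ↔
      ∀ τ : I, α τ = g x τ + ∫ s in (0 : ℝ)..(τ : ℝ), Y (IccExtend zero_le_one α s) := by
  rw [forcedRobbinMap_eq_zero_iff]
  simp_rw [IccExtend_nemytskii_eq hY]

/-- The interval integral of a pair of continuous functions is the pair of the integrals.
[folklore] -/
theorem intervalIntegral_prodMk_eq [CompleteSpace E] {f g : ℝ → E} (hf : Continuous f)
    (hg : Continuous g) (a b : ℝ) :
    ∫ s in a..b, (f s, g s) = (∫ s in a..b, f s, ∫ s in a..b, g s) := by
  have hfg : Continuous fun s => (f s, g s) := hf.prodMk hg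
  have h1 := (ContinuousLinearMap.fst ℝ E E).intervalIntegral_comp_comm
    (hfg.intervalIntegrable (μ := volume) a b)
  have h2 := (ContinuousLinearMap.snd ℝ E E).intervalIntegral_comp_comm
    (hfg.intervalIntegrable (μ := volume) a b)
  simp only [ContinuousLinearMap.coe_fst', ContinuousLinearMap.coe_snd'] at h1 h2
  exact Prod.ext h1.symm h2.symm

/-! ## 2. The jet system and its solution family -/

/-- The **jet field** `Y₁(v, w) = (Y v, DY(v) w)` on `E × E`. [cite: Hartman2002, Ch. V Thm. 3.1] -/
def jetField (Y : E → E) (q : E × E) : E × E := (Y q.1, fderiv ℝ Y q.1 q.2)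

/-- The **jet** `F₁(x, δ) = (F x, DF(x) δ)` of a curve-valued map, over the parameter space
`X × X`. [cite: Hartman2002, Ch. V Thm. 3.1] -/
def jetCurve (F : X → C(I, E)) (p : X × X) : C(I, E × E) :=
  pairCurve (F p.1, fderiv ℝ F p.1 p.2)

/-- Unfolding `jetCurve` at a time. [folklore] -/
@[simp] theorem jetCurve_apply (F : X → C(I, E)) (p : X × X) (τ : I) :
    jetCurve F p τ = (F p.1 τ, fderiv ℝ F p.1 p.2 τ) := rfl

/-- `n + 1` as an extended smoothness exponent dominates `n` by one. [folklore] -/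
theorem withTop_add_one_le (n : ℕ∞) : (n : WithTop ℕ∞) + 1 ≤ ((n + 1 : ℕ∞) : WithTop ℕ∞) :=
  le_of_eq (by push_cast; rfl)

/-- `2 ≤ n + 1` as extended smoothness exponents when `1 ≤ n`. [folklore] -/
theorem two_le_withTop_add_one {n : ℕ∞} (hn : 1 ≤ n) :
    (2 : WithTop ℕ∞) ≤ ((n + 1 : ℕ∞) : WithTop ℕ∞) := by
  have h' : (1 : ℕ∞) + 1 ≤ n + 1 := by gcongr
  have h'' : ((1 + 1 : ℕ∞) : WithTop ℕ∞) ≤ ((n + 1 : ℕ∞) : WithTop ℕ∞) := by exact_mod_cast h'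
  have h2eq : (2 : WithTop ℕ∞) = ((1 + 1 : ℕ∞) : WithTop ℕ∞) := by norm_num
  rw [h2eq]; exact h''

/-- The jet field of a `C^{n+1}` field is `C^n`. [folklore] -/
theorem contDiff_jetField {n : ℕ∞} {Y : E → E} (hY : ContDiff ℝ (n + 1 : ℕ∞) Y) :
    ContDiff ℝ n (jetField Y) := by
  have h2 : ContDiff ℝ n fun q : E × E => fderiv ℝ Y q.1 q.2 :=
    hY.contDiff_fderiv_apply (withTop_add_one_le n)
  exact ((hY.of_le (by exact_mod_cast le_self_add)).comp contDiff_fst).prodMk h2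

/-- The jet of a `C^{n+1}` curve-valued map is `C^n`. [folklore] -/
theorem contDiff_jetCurve {n : ℕ∞} {F : X → C(I, E)} (hF : ContDiff ℝ (n + 1 : ℕ∞) F) :
    ContDiff ℝ n (jetCurve F) := by
  have h1 : ContDiff ℝ n fun p : X × X => F p.1 :=
    (hF.of_le (by exact_mod_cast le_self_add)).comp contDiff_fst
  have h2 : ContDiff ℝ n fun p : X × X => fderiv ℝ F p.1 p.2 :=
    hF.contDiff_fderiv_apply (withTop_add_one_le n)
  have h := (pairCurve (E := E)).contDiff.comp (h1.prodMk h2)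
  have hfun : jetCurve F = (⇑(pairCurve (E := E)) ∘ fun p : X × X => (F p.1, fderiv ℝ F p.1 p.2)) :=
    rfl
  rw [hfun]; exact h

/-- **The derivative of the jet field**: `DY₁(v, w)(a, b) = (DY(v) a, DY(v) b + D²Y(v)[a] w)`.
[cite: Hartman2002, Ch. V Thm. 3.1] -/
theorem fderiv_jetField_apply {n : ℕ∞} {Y : E → E} (hY : ContDiff ℝ (n + 1 : ℕ∞) Y) (hn : 1 ≤ n)
    (v w a b : E) :
    fderiv ℝ (jetField Y) (v, w) (a, b) =
      (fderiv ℝ Y v a, fderiv ℝ Y v b + fderiv ℝ (fderiv ℝ Y) v a w) := by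
  have h2 := two_le_withTop_add_one hn
  have hYd : Differentiable ℝ Y := hY.differentiable (by positivity)
  have hY'd : Differentiable ℝ (fderiv ℝ Y) :=
    (hY.fderiv_right (m := 1) (by exact h2)).differentiable one_ne_zero
  have hA : HasFDerivAt (fun q : E × E => Y q.1)
      ((fderiv ℝ Y v).comp (ContinuousLinearMap.fst ℝ E E)) (v, w) :=
    (hYd v).hasFDerivAt.comp (v, w) hasFDerivAt_fst
  have hc : HasFDerivAt (fun q : E × E => fderiv ℝ Y q.1)
      ((fderiv ℝ (fderiv ℝ Y) v).comp (ContinuousLinearMap.fst ℝ E E)) (v, w) :=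
    (hY'd v).hasFDerivAt.comp (v, w) hasFDerivAt_fst
  have hB := hc.clm_apply (hasFDerivAt_snd (p := (v, w)))
  have h := (hA.prodMk hB).fderiv
  show fderiv ℝ (fun q : E × E => (Y q.1, fderiv ℝ Y q.1 q.2)) (v, w) (a, b) = _
  rw [h]
  simp

variable [CompleteSpace E] [CompleteSpace X]

/-- **The jet is the solution family of the jet system** (Hartman, Ch. V, Thm 3.1, for forcing
parameters): `S₁(x, δ) = (S x, DS(x) δ)` satisfies `S₁ = g₁ + ∫₀ Y₁ ∘ S₁` with `Y₁ = jetField Y`,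
`g₁ = jetCurve g`, and it is the ONLY solution for each `(x, δ)` (uniqueness of `S` in the first
component, `volterra_unique` in the second). [cite: Hartman2002, Ch. V Thm. 3.1] -/
theorem jetCurve_forcedSolution_family {n : ℕ∞} {Y : E → E} {g : X → C(I, E)}
    (hY : ContDiff ℝ n Y) (hg : ContDiff ℝ n g) (hn : 1 ≤ n) {S : X → C(I, E)}
    (hS : ∀ x, forcedRobbinMap Y g (x, S x) = 0)
    (huniq : ∀ x α, forcedRobbinMap Y g (x, α) = 0 → α = S x) :
    (∀ p : X × X, forcedRobbinMap (jetField Y) (jetCurve g) (p, jetCurve S p) = 0) ∧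
      ∀ (p : X × X) (α : C(I, E × E)),
        forcedRobbinMap (jetField Y) (jetCurve g) (p, α) = 0 → α = jetCurve S p := by
  have hn0 : (n : WithTop ℕ∞) ≠ 0 := by
    have : n ≠ 0 := by rintro rfl; exact absurd hn (by simp)
    exact_mod_cast this
  have hYc : Continuous Y := hY.continuous
  have hY'c : Continuous (fderiv ℝ Y) := hY.continuous_fderiv hn0
  have hJc : Continuous (jetField Y) := (hYc.comp continuous_fst).prodMk
    ((hY'c.comp continuous_fst).clm_apply continuous_snd)
  have hc1 : ∀ α : C(I, E), Continuous fun s : ℝ => Y (IccExtend zero_le_one α s) := fun α =>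
    hYc.comp (continuous_IccExtend_coe α)
  have hc2 : ∀ α w : C(I, E), Continuous fun s : ℝ =>
      fderiv ℝ Y (IccExtend zero_le_one α s) (IccExtend zero_le_one w s) := fun α w =>
    (hY'c.comp (continuous_IccExtend_coe α)).clm_apply (continuous_IccExtend_coe w)
  -- the jet integrand along a pair of curves, componentwise
  have hsplit : ∀ (α w : C(I, E)) (s : ℝ),
      jetField Y (IccExtend zero_le_one (α.prodMk w) s) =
        (Y (IccExtend zero_le_one α s),
          fderiv ℝ Y (IccExtend zero_le_one α s) (IccExtend zero_le_one w s)) := fun α w s => rfl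
  -- the two scalar equations satisfied by `S x` and `DS(x) δ`
  have hSeq : ∀ (x : X) (τ : I), S x τ = g x τ +
      ∫ s in (0 : ℝ)..(τ : ℝ), Y (IccExtend zero_le_one (S x) s) := fun x =>
    (forcedRobbinMap_eq_zero_iff_integral hYc g x (S x)).1 (hS x)
  have hweq : ∀ (x δ : X) (τ : I), fderiv ℝ S x δ τ = fderiv ℝ g x δ τ +
      ∫ s in (0 : ℝ)..(τ : ℝ), fderiv ℝ Y (IccExtend zero_le_one (S x) s)
        (IccExtend zero_le_one (fderiv ℝ S x δ) s) := fun x δ τ => by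
    rw [fderiv_forcedSolution_family_apply hY hg hn hS huniq x δ τ]
    simp_rw [IccExtend_applyCLM_nemytskii_eq hY'c]
  refine ⟨fun p => ?_, fun p α hα => ?_⟩
  · rw [forcedRobbinMap_eq_zero_iff_integral hJc]
    intro τ
    rw [jetCurve, pairCurve_apply]
    simp_rw [hsplit, intervalIntegral_prodMk_eq (hc1 (S p.1)) (hc2 (S p.1) (fderiv ℝ S p.1 p.2))]
    refine Prod.ext ?_ ?_
    · simpa using hSeq p.1 τ
    · simpa using hweq p.1 p.2 τ
  · set α₁ : C(I, E) := ((ContinuousLinearMap.fst ℝ E E).compLeftContinuous ℝ I) α with hα₁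
    set α₂ : C(I, E) := ((ContinuousLinearMap.snd ℝ E E).compLeftContinuous ℝ I) α with hα₂
    have hαeq : α = α₁.prodMk α₂ := by ext τ <;> rfl
    rw [hαeq, forcedRobbinMap_eq_zero_iff_integral hJc] at hα
    simp_rw [jetCurve_apply, hsplit, intervalIntegral_prodMk_eq (hc1 α₁) (hc2 α₁ α₂)] at hα
    have h1 : ∀ τ : I, α₁ τ = g p.1 τ +
        ∫ s in (0 : ℝ)..(τ : ℝ), Y (IccExtend zero_le_one α₁ s) := fun τ => by
      simpa using congrArg Prod.fst (hα τ)
    have hα₁S : α₁ = S p.1 :=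
      huniq p.1 α₁ ((forcedRobbinMap_eq_zero_iff_integral hYc g p.1 α₁).2 h1)
    have h2 : ∀ τ : I, α₂ τ = fderiv ℝ g p.1 p.2 τ +
        ∫ s in (0 : ℝ)..(τ : ℝ), fderiv ℝ Y (IccExtend zero_le_one (S p.1) s)
          (IccExtend zero_le_one α₂ s) := fun τ => by
      have := congrArg Prod.snd (hα τ)
      rw [hα₁S] at this
      simpa using this
    -- both `α₂` and `DS δ` solve the linear Volterra equation: uniqueness
    set A : C(I, E →L[ℝ] E) := nemytskii (fderiv ℝ Y) (S p.1) with hA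
    have hvolt : ∀ w : C(I, E), (∀ τ : I, w τ = fderiv ℝ g p.1 p.2 τ +
        ∫ s in (0 : ℝ)..(τ : ℝ), fderiv ℝ Y (IccExtend zero_le_one (S p.1) s)
          (IccExtend zero_le_one w s)) → w = fderiv ℝ g p.1 p.2 + volterraCLM A w := by
      intro w hw
      ext τ
      rw [ContinuousMap.add_apply, volterraCLM_apply, hw τ]
      simp_rw [hA, IccExtend_applyCLM_nemytskii_eq hY'c]
    have hα₂w : α₂ = fderiv ℝ S p.1 p.2 :=
      volterra_unique A (hvolt α₂ h2) (hvolt _ (hweq p.1 p.2))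
    rw [hαeq, hα₁S, hα₂w, jetCurve, pairCurve_apply]

/-- The solution family of `C^{n+1}` data is `C^{n+1}`. [folklore] -/
theorem contDiff_forcedSolution_family {n : ℕ∞} {Y : E → E} {g : X → C(I, E)}
    (hY : ContDiff ℝ n Y) (hg : ContDiff ℝ n g) (hn : 1 ≤ n)
    {S : X → C(I, E)} (hS : ∀ x, forcedRobbinMap Y g (x, S x) = 0)
    (huniq : ∀ x α, forcedRobbinMap Y g (x, α) = 0 → α = S x) : ContDiff ℝ n S :=
  contDiff_iff_contDiffAt.2 fun x => contDiffAt_forcedSolution_family hY hg hn hS huniq x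

omit [CompleteSpace E] [CompleteSpace X] in
/-- **The first variation of the jet in the direction `(δ', 0)` is `(w_δ', D²S[δ'][δ])`**:
`D S₁(x₀, δ)(δ', 0) = (DS(x₀) δ', D²S(x₀)[δ'][δ])` (chain rule; `S` is `C²`). [folklore] -/
theorem fderiv_jetCurve_apply_inl {n : ℕ∞} {S : X → C(I, E)} (hSd : ContDiff ℝ (n + 1 : ℕ∞) S)
    (hn : 1 ≤ n) (x₀ δ δ' : X) :
    fderiv ℝ (jetCurve S) (x₀, δ) (δ', 0) =
      (fderiv ℝ S x₀ δ').prodMk (fderiv ℝ (fderiv ℝ S) x₀ δ' δ) := by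
  have h2 := two_le_withTop_add_one hn
  have hSd' : Differentiable ℝ S := hSd.differentiable (by positivity)
  have hS'd : Differentiable ℝ (fderiv ℝ S) :=
    (hSd.fderiv_right (m := 1) (by exact h2)).differentiable one_ne_zero
  have hA : HasFDerivAt (fun p : X × X => S p.1)
      ((fderiv ℝ S x₀).comp (ContinuousLinearMap.fst ℝ X X)) (x₀, δ) :=
    (hSd' x₀).hasFDerivAt.comp (x₀, δ) hasFDerivAt_fst
  have hB := hasFDerivAt_apply_fst_snd (p := (x₀, δ)) (hS'd x₀).hasFDerivAt
  have h := ((pairCurve (E := E)).hasFDerivAt.comp (x₀, δ) (hA.prodMk hB)).fderiv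
  have hfun : jetCurve S = (⇑(pairCurve (E := E)) ∘ fun p : X × X => (S p.1, fderiv ℝ S p.1 p.2)) :=
    rfl
  rw [hfun, h]; simp

/-! ## 3. The second-variation equation -/

/-- **The second-variation equation of a forced integral equation.** For `C^{n+1}` data
(`n ≥ 1`) and the solution family `S`, the second derivative `W = D²S(x₀)[δ'][δ]` solves, for
`τ ∈ [0, 1]`,
`W(τ) = D²g(x₀)[δ'][δ](τ) + ∫₀^τ (D²Y(S x₀(s))[w_δ'(s)][w_δ(s)] + DY(S x₀(s)) W(s)) ds`,
`w_• = DS(x₀) •` (bars = extension by constants; the variational equation of the jet system,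
second component). [cite: Hartman2002, Ch. V Thm. 3.1] -/
theorem fderiv_fderiv_forcedSolution_family_apply {n : ℕ∞} {Y : E → E} {g : X → C(I, E)}
    (hY : ContDiff ℝ (n + 1 : ℕ∞) Y) (hg : ContDiff ℝ (n + 1 : ℕ∞) g) (hn : 1 ≤ n)
    {S : X → C(I, E)} (hS : ∀ x, forcedRobbinMap Y g (x, S x) = 0)
    (huniq : ∀ x α, forcedRobbinMap Y g (x, α) = 0 → α = S x) (x₀ δ δ' : X) (τ : I) :
    fderiv ℝ (fderiv ℝ S) x₀ δ' δ τ = fderiv ℝ (fderiv ℝ g) x₀ δ' δ τ +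
      ∫ s in (0 : ℝ)..(τ : ℝ),
        (fderiv ℝ (fderiv ℝ Y) (IccExtend zero_le_one (S x₀) s)
            (IccExtend zero_le_one (fderiv ℝ S x₀ δ') s)
            (IccExtend zero_le_one (fderiv ℝ S x₀ δ) s) +
          fderiv ℝ Y (IccExtend zero_le_one (S x₀) s)
            (IccExtend zero_le_one (fderiv ℝ (fderiv ℝ S) x₀ δ' δ) s)) := by
  have hY' : ContDiff ℝ n Y := hY.of_le (by exact_mod_cast le_self_add)
  have hg' : ContDiff ℝ n g := hg.of_le (by exact_mod_cast le_self_add)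
  have hn0 : (n : WithTop ℕ∞) ≠ 0 := by
    have : n ≠ 0 := by rintro rfl; exact absurd hn (by simp)
    exact_mod_cast this
  have hn1 : (1 : ℕ∞) ≤ n + 1 := le_add_self
  obtain ⟨h1, h2⟩ := jetCurve_forcedSolution_family hY' hg' hn hS huniq
  have hSd : ContDiff ℝ (n + 1 : ℕ∞) S := contDiff_forcedSolution_family hY hg hn1 hS huniq
  -- the variational equation of the jet system at `(x₀, δ)` in the direction `(δ', 0)`
  have hv := fderiv_forcedSolution_family_apply (contDiff_jetField hY) (contDiff_jetCurve hg) hn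
    (S := jetCurve S) h1 h2 (x₀, δ) (δ', 0) τ
  rw [fderiv_jetCurve_apply_inl hSd hn, fderiv_jetCurve_apply_inl hg hn] at hv
  have hJ'c : Continuous (fderiv ℝ (jetField Y)) := (contDiff_jetField hY).continuous_fderiv hn0
  simp_rw [IccExtend_applyCLM_nemytskii_eq hJ'c] at hv
  have hev : ∀ s : ℝ, IccExtend zero_le_one (jetCurve S (x₀, δ)) s =
      (IccExtend zero_le_one (S x₀) s, IccExtend zero_le_one (fderiv ℝ S x₀ δ) s) := fun s => rfl
  simp_rw [hev, IccExtend_prodMk, fderiv_jetField_apply hY hn] at hv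
  -- split the integral of the pair
  have hY'c : Continuous (fderiv ℝ Y) := hY.continuous_fderiv (by simp)
  have hY''c : Continuous (fderiv ℝ (fderiv ℝ Y)) := by
    have h2 := two_le_withTop_add_one hn
    exact (hY.fderiv_right (m := 1) (by exact h2)).continuous_fderiv one_ne_zero
  set zS := IccExtend zero_le_one (S x₀) with hzS
  set w' := IccExtend zero_le_one (fderiv ℝ S x₀ δ') with hw'
  set w := IccExtend zero_le_one (fderiv ℝ S x₀ δ) with hw
  set W := IccExtend zero_le_one (fderiv ℝ (fderiv ℝ S) x₀ δ' δ) with hW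
  have hcS : Continuous zS := continuous_IccExtend_coe _
  have hcw' : Continuous w' := continuous_IccExtend_coe _
  have hcw : Continuous w := continuous_IccExtend_coe _
  have hcW : Continuous W := continuous_IccExtend_coe _
  have hf : Continuous fun s => fderiv ℝ Y (zS s) (w' s) := (hY'c.comp hcS).clm_apply hcw'
  have hg2 : Continuous fun s =>
      fderiv ℝ Y (zS s) (W s) + fderiv ℝ (fderiv ℝ Y) (zS s) (w' s) (w s) :=
    ((hY'c.comp hcS).clm_apply hcW).add (((hY''c.comp hcS).clm_apply hcw').clm_apply hcw)
  rw [intervalIntegral_prodMk_eq hf hg2] at hv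
  have hsnd := congrArg Prod.snd hv
  simp only [ContinuousMap.prod_eval, Prod.snd_add] at hsnd
  rw [hsnd]
  congr 1
  refine intervalIntegral.integral_congr fun s _ => ?_
  exact add_comm _ _

omit [CompleteSpace E] [CompleteSpace X] in
/-- **`D²` of a smooth family evaluated at a time**: for a `C^{n+1}` curve-valued map `S`
(`n ≥ 1`), `D(x ↦ D(y ↦ S y τ)(x) δ)(x₀) δ' = D²S(x₀)[δ'][δ](τ)`. [folklore] -/
theorem fderiv_fderiv_eval_apply {n : ℕ∞} {S : X → C(I, E)} (hSd : ContDiff ℝ (n + 1 : ℕ∞) S)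
    (hn : 1 ≤ n) (x₀ δ δ' : X) (τ : I) :
    fderiv ℝ (fun x => fderiv ℝ (fun y => S y τ) x δ) x₀ δ' =
      fderiv ℝ (fderiv ℝ S) x₀ δ' δ τ := by
  have h2 := two_le_withTop_add_one hn
  have hSd' : Differentiable ℝ S := hSd.differentiable (by positivity)
  have hS'd : Differentiable ℝ (fderiv ℝ S) :=
    (hSd.fderiv_right (m := 1) (by exact h2)).differentiable one_ne_zero
  -- `D(y ↦ S y τ)(x) δ = (DS(x) δ)(τ)`
  have hfirst : (fun x => fderiv ℝ (fun y => S y τ) x δ) =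
      fun x => ContinuousMap.evalCLM ℝ τ (fderiv ℝ S x δ) := by
    funext x
    have h : HasFDerivAt (fun y => S y τ) ((ContinuousMap.evalCLM ℝ τ).comp (fderiv ℝ S x)) x := by
      have h' := (ContinuousMap.evalCLM ℝ τ (M := E)).hasFDerivAt.comp x (hSd' x).hasFDerivAt
      exact h'
    rw [h.fderiv]
    rfl
  have hc : HasFDerivAt (fun x => fderiv ℝ S x δ) ((fderiv ℝ (fderiv ℝ S) x₀).flip δ) x₀ := by
    have h := (hS'd x₀).hasFDerivAt.clm_apply (hasFDerivAt_const δ x₀)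
    simpa using h
  have hcomp := ((ContinuousMap.evalCLM ℝ τ (M := E)).hasFDerivAt.comp x₀ hc).fderiv
  rw [hfirst]
  show fderiv ℝ (⇑(ContinuousMap.evalCLM ℝ τ (M := E)) ∘ fun x => fderiv ℝ S x δ) x₀ δ' = _
  rw [hcomp]
  rfl

end ForcedJet

end Summit.AtomisticToContinuum.FouriersLaw.Theorems.ExtensiveSnapshotIrreversibility.EnergyWindow

end
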